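import Literature.Probability.RandomPlanarGeometry.ArcHullDomains
import Literature.Topology.PlaneTopology.CrosscutProofs
import HarnessLib

/-!
# Crux `SAWDevelopingMap.ObservableToSLE` (stmt-CriticalPhenomena-10472), line
`floor-ratio-restriction-bootstrap`: cutting a Jordan domain along a cross-cut (helper for STUB 4b)

Landing target:
`Summits/CriticalPhenomena/SAWScalingLimit/Theorems/SAWDevelopingMapObservableToSLEHullApproxCut.lean`
(`--supports stmt-CriticalPhenomena-10472`).

The D-side, conformal-map-free step of the "hull approximation from outside" (STUB 4b,
`stub_hullApproxDomain`): a cross-cut `L` of a Jordan domain `D₁` splits `D₁ ∖ L` into two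
domains (Newman's cross-cut theorem, `Newman1939_crosscut_holds`); if `D₁ ∖ L = X ⊔ Y` is any
decomposition into two nonempty open sets then `X` is one of the two sides, its frontier is the
Jordan curve "`L` followed by one of the two boundary arcs" (`IsSimpleArc.exists_periodic_of_union`),
and `X` carries the structure of a Dobrushin domain with any two prescribed distinct marked
points of `∂X ∖ L`.

* `side_eq_of_union` — the case analysis identifying `X` with one of Newman's two sides;
* `stub_hullApproxDomain_cut` — **`X` is the carrier of a Dobrushin domain** with prescribed
  marked points (registered sub-goal of STUB 4b).
-/

noncomputable section

open Set Filter Topology Metric Function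
open Literature.Probability.RandomPlanarGeometry
open Literature.Topology.PlaneTopology

namespace Summit.CriticalPhenomena.SAWScalingLimit.Theorems.ObservableToSLE.FloorRatio

/-- **One side of a cross-cut.** If `D₁ ∖ L = X ⊔ Y` with `X`, `Y` open and nonempty, for a
cross-cut `L` of the Jordan domain `D₁` from `boundary s` to `boundary t` (`s < t < s + 1`), then
`X` is connected and `∂X = L ∪ boundary [s', t']` for one of the two boundary arcs
(`(s', t') = (s, t)` or `(t, s + 1)`), by Newman's cross-cut theorem. [cite: Newman1939, Ch. V §11, Thms. 11·7 and 11·8, pp. 94–95] -/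
theorem side_eq_of_union (D₁ : JordanDomain) {L : Set ℂ} {s t : ℝ} (hst : s < t)
    (hts : t < s + 1) (hL : D₁.IsCrosscut L (D₁.boundary s) (D₁.boundary t)) {X Y : Set ℂ}
    (hXo : IsOpen X) (hYo : IsOpen Y) (hXY : Disjoint X Y) (hXne : X.Nonempty)
    (hYne : Y.Nonempty) (hunion : X ∪ Y = D₁.carrier \ L) :
    ∃ s' t' : ℝ, s' < t' ∧ t' < s' + 1 ∧
      (D₁.boundary s' = D₁.boundary s ∧ D₁.boundary t' = D₁.boundary t ∨
        D₁.boundary s' = D₁.boundary t ∧ D₁.boundary t' = D₁.boundary s) ∧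
      IsConnected X ∧ frontier X = L ∪ D₁.boundary '' Icc s' t' := by
  obtain ⟨U₁, U₂, hU₁o, hU₂o, hU₁c, hU₂c, hdisj, hU, hf₁, hf₂⟩ :=
    Newman1939_crosscut_holds D₁ L s t hst hts hL
  have hsub : U₁ ∪ U₂ ⊆ X ∪ Y := by rw [hunion, hU]
  have h₁ : U₁ ⊆ X ∨ U₁ ⊆ Y :=
    hU₁c.isPreconnected.subset_or_subset hXo hYo hXY (subset_union_left.trans hsub)
  have h₂ : U₂ ⊆ X ∨ U₂ ⊆ Y :=
    hU₂c.isPreconnected.subset_or_subset hXo hYo hXY (subset_union_right.trans hsub)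
  have hXsub : X ⊆ U₁ ∪ U₂ := by rw [hU, ← hunion]; exact subset_union_left
  have hYsub : Y ⊆ U₁ ∪ U₂ := by rw [hU, ← hunion]; exact subset_union_right
  -- `X` is `U₁` or `U₂`
  have hcases : X = U₁ ∨ X = U₂ := by
    rcases h₁ with h₁ | h₁ <;> rcases h₂ with h₂ | h₂
    · exfalso
      obtain ⟨y, hy⟩ := hYne
      have hyX : y ∈ X := (hYsub hy).elim (fun h ↦ h₁ h) (fun h ↦ h₂ h)
      exact Set.disjoint_left.1 hXY hyX hy
    · left
      refine Subset.antisymm (fun x hx ↦ ?_) h₁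
      rcases hXsub hx with h | h
      · exact h
      · exact absurd (h₂ h) (Set.disjoint_left.1 hXY hx)
    · right
      refine Subset.antisymm (fun x hx ↦ ?_) h₂
      rcases hXsub hx with h | h
      · exact absurd (h₁ h) (Set.disjoint_left.1 hXY hx)
      · exact h
    · exfalso
      obtain ⟨x, hx⟩ := hXne
      have hxY : x ∈ Y := (hXsub hx).elim (fun h ↦ h₁ h) (fun h ↦ h₂ h)
      exact Set.disjoint_left.1 hXY hx hxY
  rcases hcases with rfl | rfl
  · exact ⟨s, t, hst, hts, Or.inl ⟨rfl, rfl⟩, hU₁c, hf₁⟩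
  · refine ⟨t, s + 1, hts, by linarith, Or.inr ⟨rfl, D₁.periodic_boundary s⟩, hU₂c, hf₂⟩

/-- **Cutting a Jordan domain along a cross-cut gives a Dobrushin domain.** Let `L` be a
cross-cut of the Jordan domain `D₁` from `boundary s` to `boundary t` (`s < t < s + 1`) and
`D₁ ∖ L = X ⊔ Y` with `X`, `Y` open and nonempty; let `p₀ ≠ p₁` be two points of `∂X` off `L`.
Then `X` is the carrier of a Dobrushin domain with marked points `p₀`, `p₁`: its frontier, `L`
followed by a boundary arc of `D₁` (Newman's cross-cut theorem), is a Jordan curve through `p₀`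
and `p₁`. Registered sub-goal `stub_hullApproxDomain_cut` of STUB 4b (`stub_hullApproxDomain`).
[cite: Newman1939, Ch. V §11, Thms. 11·7 and 11·8, pp. 94–95] -/
theorem stub_hullApproxDomain_cut :
    ∀ (D₁ : JordanDomain) (L : Set ℂ) (s t : ℝ) (X Y : Set ℂ) (p₀ p₁ : ℂ),
      s < t → t < s + 1 → D₁.IsCrosscut L (D₁.boundary s) (D₁.boundary t) →
      IsOpen X → IsOpen Y → Disjoint X Y → X.Nonempty → Y.Nonempty →
      X ∪ Y = D₁.carrier \ L → p₀ ≠ p₁ →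
      p₀ ∈ closure X → p₀ ∉ X → p₀ ∉ L → p₁ ∈ closure X → p₁ ∉ X → p₁ ∉ L →
      ∃ D₂ : DobrushinDomain, D₂.carrier = X ∧ D₂.pt 0 = p₀ ∧ D₂.pt 1 = p₁ := by
  intro D₁ L s t X Y p₀ p₁ hst hts hL hXo hYo hXY hXne hYne hunion hp hp₀ hp₀X hp₀L hp₁ hp₁X hp₁L
  classical
  obtain ⟨s', t', hs't', ht's', hends, hXc, hfr⟩ :=
    side_eq_of_union D₁ hst hts hL hXo hYo hXY hXne hYne hunion
  obtain ⟨hLarc, -, -, -, hLD⟩ := hL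
  -- the two arcs of `∂X`
  set A' : Set ℂ := D₁.boundary '' Icc s' t' with hA'
  have hA'arc : IsSimpleArc A' (D₁.boundary s') (D₁.boundary t') :=
    D₁.isSimpleArc_image_boundary hs't' ht's'
  have hLarc' : IsSimpleArc L (D₁.boundary t') (D₁.boundary s') := by
    rcases hends with ⟨h1, h2⟩ | ⟨h1, h2⟩
    · rw [h1, h2]; exact hLarc.symm
    · rw [h1, h2]; exact hLarc
  have hA'F : A' ⊆ frontier D₁.carrier := by
    rintro _ ⟨v, -, rfl⟩
    exact D₁.boundary_mem_frontier v
  have hinter : A' ∩ L ⊆ {D₁.boundary s', D₁.boundary t'} := by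
    rintro z ⟨hzA, hzL⟩
    have hz : z ∈ ({D₁.boundary s, D₁.boundary t} : Set ℂ) := by
      by_contra hz
      exact Set.disjoint_left.1 D₁.disjoint_carrier_frontier (hLD ⟨hzL, hz⟩) (hA'F hzA)
    rcases hends with ⟨h1, h2⟩ | ⟨h1, h2⟩
    · rw [h1, h2]; exact hz
    · rw [h1, h2]
      rcases hz with h | h
      · exact Or.inr h
      · exact Or.inl h
  -- the Jordan curve `∂X = A' ∪ L`
  obtain ⟨ℓ, hℓc, hℓp, hℓi, hℓr⟩ := hA'arc.exists_periodic_of_union hLarc' hinter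
  have hrange : range ℓ = frontier X := by rw [hℓr, hfr, union_comm]
  have hXD : X ⊆ D₁.carrier := fun x hx ↦ by
    have : x ∈ X ∪ Y := Or.inl hx
    rw [hunion] at this
    exact this.1
  have hfrX : frontier X = closure X \ X := by
    rw [frontier, hXo.interior_eq]
  -- parameters of the marked points
  have hp₀f : p₀ ∈ range ℓ := by rw [hrange, hfrX]; exact ⟨hp₀, hp₀X⟩
  have hp₁f : p₁ ∈ range ℓ := by rw [hrange, hfrX]; exact ⟨hp₁, hp₁X⟩
  obtain ⟨τ₀, hτ₀⟩ := hp₀f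
  obtain ⟨τ₁, hτ₁⟩ := hp₁f
  have hτ : ¬ ∃ z : ℤ, τ₁ - τ₀ = z := by
    rintro ⟨z, hz⟩
    have h1 : ℓ τ₁ = ℓ τ₀ := by
      rw [show τ₁ = τ₀ + z by linarith]
      simpa using hℓp.int_mul z τ₀
    exact hp (by rw [← hτ₀, ← hτ₁, h1])
  have hfract : 0 < Int.fract (τ₁ - τ₀) := by
    rcases (Int.fract_nonneg (τ₁ - τ₀)).lt_or_eq with h | h
    · exact h
    · exfalso
      refine hτ ⟨⌊τ₁ - τ₀⌋, ?_⟩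
      have := Int.fract_add_floor (τ₁ - τ₀)
      linarith
  let D₂ : DobrushinDomain :=
    { carrier := X
      boundary := fun u ↦ ℓ (u + τ₀)
      isOpen := hXo
      isBounded := D₁.isBounded.subset hXD
      isConnected := hXc
      continuous_boundary := hℓc.comp (continuous_id.add continuous_const)
      periodic_boundary := fun u ↦ by
        show ℓ (u + 1 + τ₀) = ℓ (u + τ₀)
        rw [add_right_comm]
        exact hℓp (u + τ₀)
      injOn_boundary := hℓp.injOn_shift hℓi τ₀
      range_boundary := by rw [range_comp_add_right ℓ τ₀, hrange]
      mark := ![0, Int.fract (τ₁ - τ₀)]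
      strictMono_mark := by
        refine Fin.strictMono_iff_lt_succ.2 fun k ↦ ?_
        fin_cases k
        simpa using hfract
      mark_mem := fun k ↦ by
        fin_cases k
        · simp
        · exact ⟨Int.fract_nonneg (τ₁ - τ₀), Int.fract_lt_one (τ₁ - τ₀)⟩ }
  refine ⟨D₂, rfl, ?_, ?_⟩
  · show ℓ (0 + τ₀) = p₀
    rw [zero_add, hτ₀]
  · show ℓ (Int.fract (τ₁ - τ₀) + τ₀) = p₁
    have : ℓ (Int.fract (τ₁ - τ₀) + τ₀) = ℓ τ₁ := by
      rw [Int.fract, show τ₁ - τ₀ - (⌊τ₁ - τ₀⌋ : ℝ) + τ₀ = τ₁ - (⌊τ₁ - τ₀⌋ : ℝ) * 1 by ring]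
      exact hℓp.sub_int_mul_eq ⌊τ₁ - τ₀⌋
    rw [this, hτ₁]

end Summit.CriticalPhenomena.SAWScalingLimit.Theorems.ObservableToSLE.FloorRatio

end
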